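import Summits.BirchSwinnertonDyer.BirchSwinnertonDyer.Theorems.ErratumRoadFiveNonSurjCornerSerreLevel
import Summits.BirchSwinnertonDyer.BirchSwinnertonDyer.Theorems.ErratumRoadFiveNonSurjCornerSerreLevelTorsionInertia
import Literature.NumberTheory.EllipticCurves.FullTwoTorsionConductorExponentProofs
import Literature.NumberTheory.EllipticCurves.SzpiroLocalDataProofs
import Literature.NumberTheory.DiophantineGeometry.ConductorRingOfIntegersProofs
import Literature.NumberTheory.Automorphic.SerreConjecture
import HarnessLib

/-!
# Route `ErratumRoadFive` (K2, `p ≥ 5`), crux `NonSurjCorner` (item stmt-BirchSwinnertonDyer-19065), child `NonSurjCornerTwinMuAn` (19948):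
# THE SERRE LEVEL OF A CORNER CLASS IS THE ADDITIVE CONDUCTOR, AND THE NEWFORM SITS AT EXACTLY THAT LEVEL
# (cell `bsd-stepL`, WIDTH-LEVER lane B `bsd-stepL-corner5-p2` g11; `--supports stmt-BirchSwinnertonDyer-19948 --as helper`)

WHAT. g10's Serre-level door (`NonSurjCornerSerreLevel.exists_newform_two_of_not_ram_of_dvd`) placed every corner class at a weight-two
newform of SOME level `M ∣ N_E` supported on the additive primes. This file pins the level down:

* §1 `factorization_serreLevel_eq` — for a mod-`p` representation `ρ̄` of `Γ_ℚ` whose level is a finite product, the exponent of a prime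
  `ℓ ≠ p` in `N(ρ̄)` is the Artin exponent `a_ℓ(ρ̄)` (bookkeeping on `serreLevel`).
* §2 `factorization_serreLevel_baseChange_of_additive` — for `E/ℚ`, `p ≥ 5`, `ρ̄ = E[p] ⊗ k`: at a prime `q` of ADDITIVE reduction,
  `ord_q N(ρ̄) = ord_q N_E = f_q(E)` (the torsion-side exponent equality of `…SerreLevelTorsionInertia` + Ogg–Saito by name), and
  `factorization_serreLevel_baseChange_eq_of_not_ram`: on the corner locus (`p` multiplicative, NO (ram) prime) `N(ρ̄)` is EXACTLY the
  additive part of `N_E`: `ord_q N(ρ̄) = f_q(E)` at additive `q`, `0` elsewhere (Kraus 1997, p. 1143).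
* §3 `exists_newform_two_serreLevel_of_not_ram_of_dvd` — THE DOOR AT THE EXACT LEVEL: granted Serre's conjecture in the strong form
  (`khare_wintenberger`, Khare–Wintenberger–Kisin 2009, BY NAME) and Ogg–Saito (BY NAME): `E[p] ⊗ 𝔽̄_p ≅ ρ̄_f` for a newform `f` of weight
  `2` and level `N = N(ρ̄) = N_add(E) := ∏_{q additive} q^{f_q(E)}`; §4 the instances by the route's binders (19948's `ClassX11a` twins,
  19065's `ClassX11b` pairs).

WHY (lane B = one `μ`-certificate per residual class; census BY SERRE LEVEL, HOME/corner5/g10–g11). A corner class is a class (g, ℘) with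
`g` new of level EXACTLY `N_add(E)`, a CONDUCTOR-SHAPED number `2^a 3^b ∏ q²` (`a ∈ {0} ∪ [2,8]`, `b ∈ {0} ∪ [2,5]`, `q ≥ 5`); so the
level census is complete for `N_add ≤ B` once the conductor-shaped levels `≤ B` are enumerated (75 of the 3 199 levels `≤ 4 000` prime
to `5`; g10 enumerated ALL levels — correct but 40× too many). HONEST FRAMING: §1–§2 unconditional except Ogg–Saito where named; §3–§4
conditional on `khare_wintenberger` and Ogg–Saito BY NAME; no `sorry`, no new definition, no new named fact; items 19065 ∕ 19948 NOT
closed; BSD proved for no curve; no summit statement touched.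
[cite: Kraus1997, p. 1143] [cite: Serre1987, §1.2, §4.6 (4.6.3)] [cite: KhareWintenberger2009, Thm. 1.2 and Thm. 9.1] [cite: Diamond1995RefinedSerre, Thm. 1.1]
-/

set_option autoImplicit false
set_option linter.dupNamespace false

noncomputable section

open scoped Classical MatrixGroups ModularForm NumberField

open WeierstrassCurve Literature.NumberTheory Literature.NumberTheory.GaloisRepresentations
  Literature.NumberTheory.EllipticCurves Literature.NumberTheory.EllipticCurves.ModularForms
  Rat.HeightOneSpectrum IsDedekindDomain IsDedekindDomain.HeightOneSpectrum
  Literature.NumberTheory.Automorphic Literature.NumberTheory.Automorphic.BCDT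
  Literature.NumberTheory.DiophantineGeometry Literature.NumberTheory.EllipticCurves.Rank1Residual
  Literature.NumberTheory.GaloisRepresentations.ModPGaloisRep
  Literature.NumberTheory.GaloisRepresentations.IsNonarchimedeanLocalField
  ValuativeRel CongruenceSubgroup
  Summit.BirchSwinnertonDyer.Rank1Residual Summit.BirchSwinnertonDyer.Rank1Residual.X11b

namespace Summit.BirchSwinnertonDyer.BirchSwinnertonDyer.Theorems.NonSurjCornerSerreLevelExact

/-! ### §1 The exponent of a prime in Serre's level -/

/-- **`ord_ℓ N(ρ̄) = a_ℓ(ρ̄)` for `ℓ ≠ p`.** For a mod-`p` representation `ρ̄ : Γ_ℚ → GL₂(k)` whose level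
`N(ρ̄) = ∏_{ℓ ≠ p} ℓ^{a_ℓ(ρ̄)}` is a genuine finite product (finite multiplicative support — always the case for `ρ̄ = E[p] ⊗ k`,
`mulSupport_serreLevel_baseChange_finite`), the exponent of the prime `ℓ_v ≠ p` in `N(ρ̄)` is `a_v(ρ̄)`. (Serre 1987, (1.2.1)–(1.2.2),
read prime by prime.) [cite: Serre1987, §1.2, (1.2.1)–(1.2.2)] -/
theorem factorization_serreLevel_eq {k : Type*} [Field k] [TopologicalSpace k] [IsTopologicalRing k]
    (p : ℕ) [Fact p.Prime] (ρ : ModPGaloisRep ℚ k 2)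
    (hfin : (Function.mulSupport fun w : HeightOneSpectrum (𝓞 ℚ) ↦
      if ((primesEquiv w : Nat.Primes) : ℕ) = p then 1
      else ((primesEquiv w : Nat.Primes) : ℕ) ^ (FramedGaloisRep.toGaloisRep ρ).artinConductorExponent w).Finite)
    (v : HeightOneSpectrum (𝓞 ℚ)) (hvp : ((primesEquiv v : Nat.Primes) : ℕ) ≠ p) :
    (serreLevel p ρ).factorization ((primesEquiv v : Nat.Primes) : ℕ) =
      (FramedGaloisRep.toGaloisRep ρ).artinConductorExponent v := by
  classical
  set a : HeightOneSpectrum (𝓞 ℚ) → ℕ := fun w ↦ (FramedGaloisRep.toGaloisRep ρ).artinConductorExponent w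
    with ha
  set P : HeightOneSpectrum (𝓞 ℚ) → ℕ := fun w ↦ ((primesEquiv w : Nat.Primes) : ℕ) with hP
  set f : HeightOneSpectrum (𝓞 ℚ) → ℕ := fun w ↦ if P w = p then 1 else P w ^ a w with hf
  have hS : serreLevel p ρ = ∏ᶠ w, f w := rfl
  have hPprime : ∀ w, (P w).Prime := fun w ↦ (primesEquiv w).2
  have hPinj : ∀ w w', P w = P w' → w = w' := fun w w' h ↦
    (primesEquiv (R := 𝓞 ℚ)).injective (Subtype.ext h)
  have hf0 : ∀ w, f w ≠ 0 := by
    intro w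
    by_cases hw : P w = p
    · rw [hf]; simp only [hw, if_true]; exact one_ne_zero
    · rw [hf]; simp only [hw, if_false]; exact pow_ne_zero _ (hPprime w).ne_zero
  -- the exponent of `ℓ_v` in one factor
  have hfac : ∀ w, (f w).factorization (P v) = if w = v then a v else 0 := by
    intro w
    by_cases hw : P w = p
    · have hwv : w ≠ v := fun h ↦ hvp (h ▸ hw)
      rw [hf]; simp only [hw, if_true, Nat.factorization_one, Finsupp.coe_zero, Pi.zero_apply, if_neg hwv]
    · rw [hf]; simp only [hw, if_false, Nat.factorization_pow, Finsupp.coe_smul, Pi.smul_apply, smul_eq_mul,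
        (hPprime w).factorization, Finsupp.single_apply]
      by_cases hwv : w = v
      · subst hwv; simp
      · have : P w ≠ P v := fun h ↦ hwv (hPinj w v h)
        simp [this, hwv]
  rw [hS, finprod_eq_prod f hfin, Nat.factorization_prod fun w _ ↦ hf0 w, Finsupp.finsetSum_apply,
    Finset.sum_congr rfl fun w _ ↦ hfac w]
  rw [Finset.sum_ite_eq' hfin.toFinset v]
  by_cases hv : v ∈ hfin.toFinset
  · rw [if_pos hv]
  · rw [if_neg hv]
    have hPv : P v ≠ p := hvp
    have hfv : f v = 1 := by
      by_contra hne
      exact hv (hfin.mem_toFinset.mpr (Function.mem_mulSupport.mpr hne))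
    have hfv' : P v ^ a v = 1 := by
      have h1 : f v = P v ^ a v := if_neg hPv
      rw [← h1, hfv]
    rcases Nat.pow_eq_one.mp hfv' with h | h
    · exact absurd h (hPprime v).one_lt.ne'
    · exact h.symm


/-! ### §2 `E/ℚ`: the level of `E[p] ⊗ k` at the additive primes, and on the corner -/

/-- The level `N(E[p] ⊗ k)` of the `p`-torsion of an elliptic curve over `ℚ` is a genuine finite product: its exponents are bounded by
those of `V_p E` (`IsTorsionGaloisRep.artinConductorExponent_baseChange_le`), which vanish at almost every place
(`artinConductorExponent_eq_zero_cofinite_holds`, `isUnramifiedAE_rationalTateGaloisRep`). (The finiteness bookkeeping of the tree's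
`IsTorsionGaloisRep.serreLevel_baseChange_dvd_conductorNatOf`, isolated.) [cite: Serre1987, §4.6, Lemme 5 (4.6.3)] -/
theorem mulSupport_serreLevel_baseChange_finite (W : WeierstrassCurve ℚ) [W.IsElliptic] (p : ℕ) [Fact p.Prime]
    {ρ : ModPGaloisRep ℚ (ZMod p) 2} (hρ : W.IsTorsionGaloisRep p ρ)
    {k : Type*} [Field k] [TopologicalSpace k] [IsTopologicalRing k] (j : ZMod p →+* k) (hj : Continuous j) :
    (Function.mulSupport fun w : HeightOneSpectrum (𝓞 ℚ) ↦
      if ((primesEquiv w : Nat.Primes) : ℕ) = p then 1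
      else ((primesEquiv w : Nat.Primes) : ℕ) ^
        (FramedGaloisRep.toGaloisRep (FramedRep.baseChange j hj ρ)).artinConductorExponent w).Finite := by
  classical
  have hprime : p.Prime := Fact.out
  have h := W.continuous_rationalGaloisRepTate_holds p
  have hPp : ∀ v : HeightOneSpectrum (𝓞 ℚ),
      ((p : 𝓞 ℚ) ∈ v.asIdeal) ↔ ((primesEquiv v : Nat.Primes) : ℕ) = p :=
    fun v ↦ natCast_mem_asIdeal_iff_primesEquiv_eq v hprime
  have hcof := GaloisRep.artinConductorExponent_eq_zero_cofinite_holds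
    (W.isUnramifiedAE_rationalTateGaloisRep p h)
  rw [Filter.eventually_cofinite] at hcof
  refine hcof.subset fun v hv ↦ ?_
  rw [Function.mem_mulSupport] at hv
  intro h0
  have h0' : conductorExponentOf (WeierstrassCurve.geomPoints W) p h v = 0 := h0
  apply hv
  by_cases hvp : ((primesEquiv v : Nat.Primes) : ℕ) = p
  · rw [if_pos hvp]
  · rw [if_neg hvp]
    have hle := hρ.artinConductorExponent_baseChange_le j hj h (mt (hPp v).mp hvp)
    rw [h0', Nat.le_zero] at hle
    rw [hle, pow_zero]

/-- **`ord_q N(E[p] ⊗ k) = ord_q N_E` at a prime `q ≠ p` of ADDITIVE reduction, `p ≥ 5`** (Kraus: at the additive primes Serre's level has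
the full conductor exponent). Granted Ogg–Saito for `(E, p)` BY NAME (`a_v(V_p E) = f_v(E)`), this is `factorization_serreLevel_eq` +
`artinConductorExponent_baseChange_eq_of_hasAdditiveReductionAt` + the tree's bridges between `f_v` over `𝓞 ℚ`, over `ℤ`, and `ord_q N_E`.
[cite: Kraus1997, p. 1143] [cite: Serre1987, §4.6 (4.6.3)] -/
theorem factorization_serreLevel_baseChange_of_additive (W : WeierstrassCurve ℚ) [W.IsElliptic] (p : ℕ) [Fact p.Prime]
    (hp5 : 5 ≤ p) (hOS : W.artinConductorExponent_tate_eq_conductorExponent_of_isElliptic p)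
    {ρ : ModPGaloisRep ℚ (ZMod p) 2} (hρ : W.IsTorsionGaloisRep p ρ)
    {k : Type*} [Field k] [TopologicalSpace k] [IsTopologicalRing k] (j : ZMod p →+* k) (hj : Continuous j)
    (q : ℕ) [Fact q.Prime] (hqp : q ≠ p)
    (hng : ¬ W.HasGoodReductionAtPrime q) (hnm : ¬ W.HasMultiplicativeReductionAtPrime q) :
    (serreLevel p (FramedRep.baseChange j hj ρ)).factorization q = (W.conductorNorm ℤ).factorization q := by
  classical
  have hprime : p.Prime := Fact.out
  have hq : q.Prime := Fact.out
  set v : HeightOneSpectrum (𝓞 ℚ) := (primesEquiv (R := 𝓞 ℚ)).symm ⟨q, hq⟩ with hvdef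
  have hv : (primesEquiv v : Nat.Primes) = ⟨q, hq⟩ := Equiv.apply_symm_apply _ _
  have hvq : ((primesEquiv v : Nat.Primes) : ℕ) = q := by rw [hv]
  have hadd : W.HasAdditiveReductionAt v := hasAdditiveReductionAt_ringOfIntegers_of_additive W q hng hnm
  have hpv : (p : 𝓞 ℚ) ∉ v.asIdeal := fun hmem ↦
    hqp (hvq.symm.trans ((natCast_mem_asIdeal_iff_primesEquiv_eq v hprime).mp hmem))
  have h := W.continuous_rationalGaloisRepTate_holds p
  have hexp := artinConductorExponent_baseChange_eq_of_hasAdditiveReductionAt hp5 hρ j hj h hpv hadd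
  rw [← hvq, factorization_serreLevel_eq p _ (mulSupport_serreLevel_baseChange_finite W p hρ j hj) v
    (hvq.symm ▸ hqp), hexp, hOS h v hpv, conductorExponent_ringOfIntegers_eq W v, hv,
    factorization_conductorNorm_primesEquiv_symm W ⟨q, hq⟩]

/-- **On the corner locus `N(E[p] ⊗ k)` is EXACTLY the additive part of `N_E`** (`p ≥ 5` a prime of MULTIPLICATIVE reduction, NO (ram)
prime: every multiplicative `ℓ ≠ p` has `p ∣ ord_ℓ Δ_min`): for every prime `q`, `ord_q N(E[p] ⊗ k) = ord_q N_E` if `E` has ADDITIVE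
reduction at `q`, and `= 0` otherwise (`q = p`: `not_dvd_serreLevel`; `q` good: Néron–Ogg–Shafarevich,
`not_dvd_serreLevel_baseChange_of_hasGoodReductionAt_int`; `q ≠ p` multiplicative: Tate curve,
`not_dvd_serreLevel_baseChange_of_hasMultiplicativeReductionAt_of_dvd_int`; `q` additive: `factorization_serreLevel_baseChange_of_additive`).
So `N(ρ̄) = N_add(E) := ∏_{q additive} q^{f_q(E)}`, a conductor-shaped number. Ogg–Saito for `(E, p)` BY NAME.
[cite: Kraus1997, p. 1143] [cite: Serre1987, §4.1 (4.1.12), §4.6 (4.6.3)] -/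
theorem factorization_serreLevel_baseChange_eq_of_not_ram (W : WeierstrassCurve ℚ) [W.IsElliptic] [W.IsGloballyMinimal]
    (p : ℕ) [Fact p.Prime] (hp5 : 5 ≤ p) (hOS : W.artinConductorExponent_tate_eq_conductorExponent_of_isElliptic p)
    (hmultp : Mult W p) (hnram : ¬ Ram W p)
    {ρ : ModPGaloisRep ℚ (ZMod p) 2} (hρ : W.IsTorsionGaloisRep p ρ)
    {k : Type*} [Field k] [TopologicalSpace k] [IsTopologicalRing k] (j : ZMod p →+* k) (hj : Continuous j)
    (q : ℕ) [Fact q.Prime] :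
    (serreLevel p (FramedRep.baseChange j hj ρ)).factorization q =
      if ¬ W.HasGoodReductionAtPrime q ∧ ¬ W.HasMultiplicativeReductionAtPrime q
      then (W.conductorNorm ℤ).factorization q else 0 := by
  classical
  have hprime : p.Prime := Fact.out
  have hq : q.Prime := Fact.out
  by_cases hadd : ¬ W.HasGoodReductionAtPrime q ∧ ¬ W.HasMultiplicativeReductionAtPrime q
  · rw [if_pos hadd]
    have hqp : q ≠ p := by
      rintro rfl
      exact hadd.2 hmultp
    exact factorization_serreLevel_baseChange_of_additive W p hp5 hOS hρ j hj q hqp hadd.1 hadd.2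
  · rw [if_neg hadd]
    apply Nat.factorization_eq_zero_of_not_dvd
    by_cases hqp : q = p
    · subst hqp
      exact not_dvd_serreLevel q _
    -- the place of `ℤ` below `q`
    obtain ⟨u, hu⟩ : ∃ u : HeightOneSpectrum ℤ, natGenerator u = q :=
      ⟨(primesEquiv (R := ℤ)).symm ⟨q, hq⟩, Rat.natGenerator_primesEquiv_symm ⟨q, hq⟩⟩
    subst hu
    rw [not_and_or, not_not, not_not] at hadd
    rcases hadd with hgood | hmult
    · exact not_dvd_serreLevel_baseChange_of_hasGoodReductionAt_int W p hρ j hj u hqp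
        ((hasGoodReductionAtPrime_primesEquiv_iff_hasGoodReductionAt W u).mp hgood)
    · have hmu : W.HasMultiplicativeReductionAt u :=
        (hasMultiplicativeReductionAtPrime_primesEquiv_iff_hasMultiplicativeReductionAt W u).mp hmult
      -- `¬ Ram`: `p ∣ ord_u Δ_min`
      have hordZ : W.ordMinimalDiscriminant u = padicValInt (natGenerator u) W.minimalDiscriminantInt := by
        rw [← W.factorization_minimalDiscriminantNorm_holds u,
          minimalDiscriminantNorm_int_eq_natAbs_minimalDiscriminantInt_holds W,
          Nat.factorization_def _ (show (natGenerator u).Prime from (primesEquiv u).2)]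
        rfl
      have hdvd : p ∣ W.ordMinimalDiscriminant u := by
        by_contra hndvd
        apply hnram
        refine ⟨natGenerator u, ⟨(primesEquiv u).2⟩, hqp, hmult, ?_⟩
        rwa [hordZ] at hndvd
      exact not_dvd_serreLevel_baseChange_of_hasMultiplicativeReductionAt_of_dvd_int W p hρ j hj u hqp
        hmu hdvd

/-! ### §3 The door at the exact level -/

/-- **THE SERRE-LEVEL DOOR AT THE EXACT LEVEL.** `p ≥ 5` multiplicative for `E`, `E[p]` irreducible, NO (ram) prime and `p ∣ ord_p(Δ_min)`
(the corner locus of items 19065 ∕ 19948) ⟹ granted Serre's conjecture in its strong form BY NAME (`khare_wintenberger`, Khare–Wintenberger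
2009 Thm. 1.2 ∕ 9.1 with Kisin; for `ρ̄ = E[p]` with `E` modular this is Ribet–Diamond level lowering at the optimal level, Diamond 1995
Thm. 1.1) and Ogg–Saito BY NAME: for the framed model `ρ` of `E[p]` and `ρ̄' = ρ ⊗ 𝔽̄_p` there is a newform `f ∈ S₂(Γ₁(N))` with
`ρ̄' ≅ ρ̄_f`, at the level `N = N(ρ̄') = N_add(E)` EXACTLY: `ord_q N = ord_q N_E` at the additive primes `q` of `E` and `0` elsewhere
(`factorization_serreLevel_baseChange_eq_of_not_ram`); in particular `N ∣ N_E`. Weight: `k(ρ̄') = 2` (multiplicative, peu ramifié: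
`serreWeight_eq_two_of_hasMultiplicativeReductionAt_of_dvd`); irreducible and odd as in g10's door.
[cite: KhareWintenberger2009, Thm. 1.2 and Thm. 9.1] [cite: Diamond1995RefinedSerre, Thm. 1.1] [cite: Kraus1997, p. 1143] [cite: Serre1987, §2.8 Prop. 4, §4.1 (4.1.12)] -/
theorem exists_newform_two_serreLevel_of_not_ram_of_dvd
    (p : ℕ) [Fact p.Prime] [TopologicalSpace (AlgebraicClosure (ZMod p))] [DiscreteTopology (AlgebraicClosure (ZMod p))]
    (hKW : khare_wintenberger p (AlgebraicClosure (ZMod p)))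
    (hOS : ∀ (W : WeierstrassCurve ℚ) (ℓ : ℕ) [Fact ℓ.Prime],
      W.artinConductorExponent_tate_eq_conductorExponent_of_isElliptic ℓ)
    (W : WeierstrassCurve ℚ) [W.IsElliptic] [W.IsGloballyMinimal]
    (hp5 : 5 ≤ p) (hmultp : Mult W p) (hirr : Irr W p) (hnram : ¬ Ram W p)
    (hpeu : p ∣ padicValInt p W.minimalDiscriminantInt)
    {ρ : ModPGaloisRep ℚ (ZMod p) 2} (hρ : W.IsTorsionGaloisRep p ρ) :
    ∃ (N : ℕ) (_ : NeZero N),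
      N = serreLevel p (FramedRep.baseChange (algebraMap (ZMod p) (AlgebraicClosure (ZMod p)))
            continuous_of_discreteTopology ρ) ∧
      (∀ (q : ℕ) [Fact q.Prime], N.factorization q =
        if ¬ W.HasGoodReductionAtPrime q ∧ ¬ W.HasMultiplicativeReductionAtPrime q
        then (W.conductorNorm ℤ).factorization q else 0) ∧
      N ∣ W.conductorNorm ℤ ∧ ¬ p ∣ N ∧
      ∃ (f : CuspForm (Gamma1 N) 2)
        (ιf : coeffCharIntegers f →+* AlgebraicClosure (ZMod p)),
        IsNewform1 f ∧ IsGaloisRepOfNewform1Int f ιf {q | q ∣ N * p}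
          (FramedRep.baseChange (algebraMap (ZMod p) (AlgebraicClosure (ZMod p)))
            continuous_of_discreteTopology ρ) := by
  classical
  have hp : p.Prime := Fact.out
  have hp2 : p ≠ 2 := by omega
  /- Step 1. `ρ̄' = ρ̄ ⊗ 𝔽̄_p`: irreducible and odd. -/
  haveI : NeZero ((p : ℕ) : ℚ) := ⟨by exact_mod_cast hp.ne_zero⟩
  set j : ZMod p →+* AlgebraicClosure (ZMod p) := algebraMap (ZMod p) (AlgebraicClosure (ZMod p))
    with hj
  set ρ' : ModPGaloisRep ℚ (AlgebraicClosure (ZMod p)) 2 :=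
    FramedRep.baseChange j continuous_of_discreteTopology ρ with hρ'
  have habs := isAbsolutelyIrreducible_of_hasIrreducibleModPGaloisRep W hp2 hirr hρ
  have hirr' : ρ'.toGaloisRep.IsIrreducible := by
    rw [← ModPGaloisRep.isIrreducible_iff_toGaloisRep]
    exact habs.isIrreducible_baseChange (AlgebraicClosure (ZMod p)) j _
  have hodd' : FramedGaloisRep.IsOdd ρ' :=
    (ModPGaloisRep.isOdd_of_det_eq_modPCyclotomicCharacterZMod ρ
      (W.det_eq_modPCyclotomicCharacter_of_isTorsionGaloisRep_holds p ρ hρ)).baseChange j _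
  /- Step 2. The canonical local datum at the place `v` above `p`; the weight is `2` (multiplicative, peu ramifié). -/
  obtain ⟨v, hv⟩ : ∃ v : HeightOneSpectrum (𝓞 ℚ), primesEquiv v = ⟨p, hp⟩ :=
    ⟨(primesEquiv (R := 𝓞 ℚ)).symm ⟨p, hp⟩, Equiv.apply_symm_apply _ _⟩
  have hpv' : (p : 𝓞 ℚ) ∈ v.asIdeal := (natCast_mem_asIdeal_iff_primesEquiv_eq v hp).mpr (by rw [hv])
  have hvs : v = (primesEquiv (R := 𝓞 ℚ)).symm ⟨p, hp⟩ := by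
    rw [Equiv.eq_symm_apply]; exact hv
  set uZ : HeightOneSpectrum ℤ := (primesEquiv (R := ℤ)).symm ⟨p, hp⟩ with huZ
  have huZp : natGenerator uZ = p := Rat.natGenerator_primesEquiv_symm ⟨p, hp⟩
  have hpe : (primesEquiv uZ : Nat.Primes) = ⟨p, hp⟩ := Equiv.apply_symm_apply _ _
  have hmultZ : W.HasMultiplicativeReductionAt uZ := by
    have h := hasMultiplicativeReductionAtPrime_primesEquiv_iff_hasMultiplicativeReductionAt W uZ
    rw [hpe] at h
    exact h.mp hmultp
  have hmultv : W.HasMultiplicativeReductionAt v := by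
    rw [hvs]; exact hasMultiplicativeReductionAt_of_int W ⟨p, hp⟩ hmultZ
  have hordZ : W.ordMinimalDiscriminant uZ = padicValInt (natGenerator uZ) W.minimalDiscriminantInt := by
    rw [← W.factorization_minimalDiscriminantNorm_holds uZ,
      minimalDiscriminantNorm_int_eq_natAbs_minimalDiscriminantInt_holds W,
      Nat.factorization_def _ (show (natGenerator uZ).Prime from (primesEquiv uZ).2)]
    rfl
  have hpordv : p ∣ W.ordMinimalDiscriminant v := by
    rw [hvs, ordMinimalDiscriminant_eq_of_int, ← huZ, hordZ, huZp]; exact hpeu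
  set loc : LocalRestrictionAt p ρ' :=
    { F := v.adicCompletion ℚ
      residueFieldCard_eq := residueFieldCard_adicCompletion_eq_of_natCast_mem hpv'
      irreducible_natCast := irreducible_natCast_valuativeInteger_adicCompletion_of_natCast_mem hpv'
      rep := FramedGaloisRep.restrictField (v.adicCompletion ℚ) ρ'
      rep_eq_restrictField := rfl } with hloc
  obtain ⟨ι⟩ := nonempty_ringHom_residue (k := AlgebraicClosure (ZMod p)) p (v.adicCompletion ℚ)
    (residueFieldCard_adicCompletion_eq_of_natCast_mem hpv')
  have hw : (serreWeight p ρ' loc ι : ℤ) = 2 := by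
    have h2 : serreWeight p ρ' loc ι = 2 :=
      serreWeight_eq_two_of_hasMultiplicativeReductionAt_of_dvd W p hp2 v hpv' hmultv hpordv hρ
        (AlgebraicClosure (ZMod p)) j ι
    rw [h2]; rfl
  /- Step 3. Khare–Wintenberger: `ρ̄'` arises from a newform of weight `k(ρ̄') = 2` and level `N(ρ̄')`. -/
  obtain ⟨f, ιf, hf, hgal⟩ := hKW ρ' hirr' hodd' loc ι
  revert hgal hf ιf f
  rw [hw]
  intro f ιf hf hgal
  /- Step 4. The level is the additive part of `N_E`. -/
  have hfac : ∀ (q : ℕ) [Fact q.Prime], (serreLevel p ρ').factorization q =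
      if ¬ W.HasGoodReductionAtPrime q ∧ ¬ W.HasMultiplicativeReductionAtPrime q
      then (W.conductorNorm ℤ).factorization q else 0 :=
    fun q _ ↦ factorization_serreLevel_baseChange_eq_of_not_ram W p hp5 (hOS W p) hmultp hnram hρ j _ q
  have hN0 : serreLevel p ρ' ≠ 0 := fun h0 ↦ not_dvd_serreLevel p ρ' (h0 ▸ dvd_zero p)
  haveI hNz : NeZero (serreLevel p ρ') := ⟨hN0⟩
  have hdvdN : serreLevel p ρ' ∣ W.conductorNorm ℤ := by
    rw [← Nat.factorization_le_iff_dvd hN0 (conductorNorm_pos_holds W).ne']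
    intro q
    by_cases hq : q.Prime
    · haveI : Fact q.Prime := ⟨hq⟩
      rw [hfac q]
      split_ifs
      · exact le_rfl
      · exact Nat.zero_le _
    · rw [Nat.factorization_eq_zero_of_not_prime _ hq]
      exact Nat.zero_le _
  exact ⟨serreLevel p ρ', hNz, rfl, hfac, hdvdN, not_dvd_serreLevel p ρ', f, ιf, hf, hgal⟩

/-! ### §4 The corner instances (the route's binders) -/

/-- **19948's population at the exact level.** For a leaf twin `Wd ∈ ClassX11a` (`r_an = 0`, `p ∥ N` odd, `E[p]` irreducible, NO (ram)
prime) at `p ∈ {5, 7}` with `p ∣ ord_p Δ_min`: granted `khare_wintenberger` and Ogg–Saito BY NAME, `Wd[p] ⊗ 𝔽̄_p ≅ ρ̄_f` for a newform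
`f ∈ S₂(Γ₁(N))` with `N = N(ρ̄) = N_add(Wd)` (exponents: `ord_q N_{Wd}` at the additive `q`, `0` elsewhere). So the lane's unit — one
`μ_an = 0` certificate per newform class (p633802 `NonSurjTwin.muAnZeroAt_of_sameNewformClass_good`) — is indexed by the newform classes of
CONDUCTOR-SHAPED level `N_add ≤ B`, finitely many and enumerable level by level. [cite: KhareWintenberger2009, Thm. 1.2 and Thm. 9.1]
[cite: Kraus1997, p. 1143] -/
theorem NonSurjTwin.exists_newform_two_serreLevel
    (p : ℕ) [Fact p.Prime] [TopologicalSpace (AlgebraicClosure (ZMod p))] [DiscreteTopology (AlgebraicClosure (ZMod p))]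
    (hKW : khare_wintenberger p (AlgebraicClosure (ZMod p)))
    (hOS : ∀ (W : WeierstrassCurve ℚ) (ℓ : ℕ) [Fact ℓ.Prime],
      W.artinConductorExponent_tate_eq_conductorExponent_of_isElliptic ℓ)
    (Wd : WeierstrassCurve ℚ) [Wd.IsElliptic] [Wd.IsGloballyMinimal]
    (hX : ClassX11a Wd p) (hp : p = 5 ∨ p = 7) (hpeu : p ∣ padicValInt p Wd.minimalDiscriminantInt)
    {ρ : ModPGaloisRep ℚ (ZMod p) 2} (hρ : Wd.IsTorsionGaloisRep p ρ) :
    ∃ (N : ℕ) (_ : NeZero N),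
      N = serreLevel p (FramedRep.baseChange (algebraMap (ZMod p) (AlgebraicClosure (ZMod p)))
            continuous_of_discreteTopology ρ) ∧
      (∀ (q : ℕ) [Fact q.Prime], N.factorization q =
        if ¬ Wd.HasGoodReductionAtPrime q ∧ ¬ Wd.HasMultiplicativeReductionAtPrime q
        then (Wd.conductorNorm ℤ).factorization q else 0) ∧
      N ∣ Wd.conductorNorm ℤ ∧ ¬ p ∣ N ∧
      ∃ (f : CuspForm (Gamma1 N) 2)
        (ιf : coeffCharIntegers f →+* AlgebraicClosure (ZMod p)),
        IsNewform1 f ∧ IsGaloisRepOfNewform1Int f ιf {q | q ∣ N * p}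
          (FramedRep.baseChange (algebraMap (ZMod p) (AlgebraicClosure (ZMod p)))
            continuous_of_discreteTopology ρ) :=
  exists_newform_two_serreLevel_of_not_ram_of_dvd p hKW hOS Wd (by rcases hp with rfl | rfl <;> norm_num)
    hX.2.2.1 hX.2.2.2.1 hX.2.2.2.2 hpeu hρ

/-- **19065's population at the exact level.** For a corner pair `W ∈ ClassX11b` (`r_an = 1`, `p ∥ N` odd, `E[p]` irreducible) with NO
(ram) prime and `p ∣ ord_p Δ_min`, `p ≥ 5`: granted `khare_wintenberger` and Ogg–Saito BY NAME, `W[p] ⊗ 𝔽̄_p ≅ ρ̄_f` for a newform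
`f ∈ S₂(Γ₁(N))`, `N = N(ρ̄) = N_add(W)` exactly. [cite: KhareWintenberger2009, Thm. 1.2 and Thm. 9.1] [cite: Kraus1997, p. 1143] -/
theorem NonSurjCorner.exists_newform_two_serreLevel
    (p : ℕ) [Fact p.Prime] [TopologicalSpace (AlgebraicClosure (ZMod p))] [DiscreteTopology (AlgebraicClosure (ZMod p))]
    (hKW : khare_wintenberger p (AlgebraicClosure (ZMod p)))
    (hOS : ∀ (W : WeierstrassCurve ℚ) (ℓ : ℕ) [Fact ℓ.Prime],
      W.artinConductorExponent_tate_eq_conductorExponent_of_isElliptic ℓ)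
    (W : WeierstrassCurve ℚ) [W.IsElliptic] [W.IsGloballyMinimal]
    (hX : ClassX11b W p) (hp5 : 5 ≤ p) (hpeu : p ∣ padicValInt p W.minimalDiscriminantInt) (hnram : ¬ Ram W p)
    {ρ : ModPGaloisRep ℚ (ZMod p) 2} (hρ : W.IsTorsionGaloisRep p ρ) :
    ∃ (N : ℕ) (_ : NeZero N),
      N = serreLevel p (FramedRep.baseChange (algebraMap (ZMod p) (AlgebraicClosure (ZMod p)))
            continuous_of_discreteTopology ρ) ∧
      (∀ (q : ℕ) [Fact q.Prime], N.factorization q =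
        if ¬ W.HasGoodReductionAtPrime q ∧ ¬ W.HasMultiplicativeReductionAtPrime q
        then (W.conductorNorm ℤ).factorization q else 0) ∧
      N ∣ W.conductorNorm ℤ ∧ ¬ p ∣ N ∧
      ∃ (f : CuspForm (Gamma1 N) 2)
        (ιf : coeffCharIntegers f →+* AlgebraicClosure (ZMod p)),
        IsNewform1 f ∧ IsGaloisRepOfNewform1Int f ιf {q | q ∣ N * p}
          (FramedRep.baseChange (algebraMap (ZMod p) (AlgebraicClosure (ZMod p)))
            continuous_of_discreteTopology ρ) :=
  exists_newform_two_serreLevel_of_not_ram_of_dvd p hKW hOS W hp5 hX.2.2.1 hX.2.2.2 hnram hpeu hρ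

end Summit.BirchSwinnertonDyer.BirchSwinnertonDyer.Theorems.NonSurjCornerSerreLevelExact

end
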